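import Mathlib
import Summits.HodgeConjecture.FermatCycles.HodgeFermatTheoremL13

/-!
# THEOREM L at `p = 7`, quotient 3 — the rows (U, Z1) and (Z1, Z1) (`HodgeFermat/SevenThree.lean`; HF-G29d)

Tree copy (whole module) of the module `HodgeFermat/SevenThree.lean` of the sibling cell's standalone package
`run/shared/lean/pub/pub-hodgefermat/lean/HodgeFermat/` (297 lines, sha256 `4f10988d29500a27…`), source lines 52–297 (all: THEOREM L at `p = 7`, quotient 3 — `row_UZ1_seven`, `row_Z1Z1_seven` by bookkeeping along `1, 7, 49, 343`).
Filed by cell `pub-hfermat`, seat prover-1 gen-3, on the COORDINATOR KEEPER RULING of 2026-08-25 (gem sweep H1: take the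
off-gate kernel theorem `thmFstar` through the gate) — here THEOREM F* of `tables/DPRIME-THEOREM.md` §9 IN FULL, i.e.
PROPOSITION D′(3N) and the descent (`HodgeFermat/PropDPrimeNFinal.lean`, GATE HF-G34), the last off-gate form of THEOREM F*
(its first two forms, `DecodingFinal.thmFstar` = F* at the prime levels and `ThmFstarNFinal.thmFstar` = F*(3N), landed on
2026-08-25 as `HodgeFermatThmFstar.lean` / `HodgeFermatThmFstarN.lean`, seats prover-1 gen-0 / gen-2); this file is one link of
the import closure of `PropDPrimeNFinal.propDprime` (the sibling's KR-free chain: THEOREM L, COROLLARY M, THEOREM D6,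
THEOREM U⁺, THEOREM KR6, THEOREM Z3U) on top of those landed chains.  The source module is the sibling's hub-checked module of
record (pub-hodgefermat `CERT.md` l.939, GATE HF-G29d); its declarations are copied VERBATIM.
Deviations from the source module, exhaustively: the `import` lines (tree modules `Summits.HodgeConjecture.FermatCycles.
HodgeFermat*` instead of `HodgeFermat.*`); this module docstring; one-line docstrings added (gate lint) to `div_three_mul`.
Every other line — in particular every declaration's statement and proof — is byte-identical to the source.
HONEST FRAMING: explicit algebraic cycles for specific Hodge classes on Fermat/Delsarte varieties; residual open instances
listed; no claim on general Hodge.  (This file is arithmetic of CM types / finite combinatorics / analytic number theory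
of the sibling's KR-free programme; it claims nothing about cycles.)

The source module's docstring (SevenThree.lean l.3–50), verbatim:

## THEOREM L at `p = 7`, quotient 3 — the rows (U, Z1) and (Z1, Z1) by bookkeeping along the chain `1, 7, 49, 343`
## (`tables/DPRIME-THEOREM.md` §3: PROPOSITION L7 (a), branch n′ = 3, and PROPOSITION L7 (b); build hodge-fermat, generation 29,
## addendum HF-G29d)

Setting (KR-FREE §0–§1, as in `LemmaN.lean` / `TheoremLRows.lean`): level `7n`, `7 ∤ n`; `T = (7y, x₂, x₃)` of pattern Z1 at 7
(`7 ∤ x₂x₃`); `T′` either a unit triple `(x′, y′, z′)` (pattern U at 7) or another Z1 triple `(7y′, x₂′, x₃′)`; `R(t) = rsum_n(T, t)`,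
`R′(t) = rsum_n(T′, t)` the reduced residue sums (`= n·c_T̄(t̄)`), `K(t) = ⌊7⟨ty⟩_n / n⌋` the digit of LEMMA N (Z1).

THEOREM L (`TheoremLRows.lean`, generation 21) bounds the two rows at `p = 7` by `n/gcd(y, n) ∈ {3, 5}` (row (U, Z1), `row_UZ1`:
`7n ≤ 14·gcd(y, n) + 5n`, with `n` odd, `7 ∤ n`, `n ∤ y`) and `n/gcd(y − y′, n) ∈ {3, 5}` (row (Z1, Z1), `row_Z1Z1`: `7(n − g) < 6n`).
The hand proof of PROPOSITION L7 (DPRIME §3) disposed of the two QUOTIENT-3 cases — (a), branch n′ = 3, and (b) — through the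
DESCENT LEMMA, a sieve over the primes of `n` and the certificates F21a and F105, for `n` squarefree and the pair jointly primitive.
THIS FILE closes both quotient-3 cases in the kernel by a shorter route that needs NONE of that — no squarefreeness, no joint
primitivity, no parity, no certificate, no DESCENT:

OBSERVATION (bookkeeping along `t ↦ 7t`).  `7 ≡ 1 (mod 3)`.  Hence, when `n = 3·gcd(y, n)`, the residue `⟨ty⟩_n ∈ {n/3, 2n/3}` is the
same at `t` and at `7t` [`mul_mod_of_one_mod_three`: `n = 3g ∣ (t − 1)·y` for `t ≡ 1 (mod 3)`], so along the chain of units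
`1, 7, 49, 343` of `ℤ/n` the digit `K` is CONSTANT, `K ∈ {2, 4}` [`K_seven`], while the fibre identity (E) of `LemmaN.lean`, applied at
the pairs `(t₀, t₁) = (7t, t)` (which satisfy `7t₁ ≡ t₀` on the nose), TELESCOPES in its `R`, `R′` terms.
* Row (U, Z1) [`uz1_seven_three`]: (E), Z1–U reads `2n·K + 2R(7t) + 2R′(t) + n = 7n + 2R(t) + 2R′(7t)`; summing over `t = 1, 7, 49`:
  `3(2K + 1)·n + 2R(343) + 2R′(1) = 21n + 2R(1) + 2R′(343)`, i.e. `∓6n = 2(R(343) − R(1)) + 2(R′(1) − R′(343))` for `K = 2` resp. `4` —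
  but `|R(1) − R(343)| ≤ n` and `|R′(1) − R′(343)| ≤ n` [`TheoremL.delta_le`]: contradiction.  In words: by (E) the average of `K` along a
  `7`-orbit of `(ℤ/n)ˣ` is `(7 − 1)/2 = 3`, which a constant `K ∈ {2, 4}` cannot have.  (Two steps do not suffice — control LF.)
* Row (Z1, Z1) [`pointwise_z1z1`, `z1z1_seven_three`]: with `z = y − y′` (represented by `y + (n−1)y′`) and `n = 3·gcd(z, n)`:
  `⟨t₀z⟩_n = ⟨z⟩_n =: w ∈ {n/3, 2n/3}` for `t₀ ≡ 1 (mod 3)` and `⟨t₀y⟩_n ≡ ⟨t₀y′⟩_n + w (mod n)`.  (E), Z1–Z1 reads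
  `n·K(t₀) + R(t₀) + R′(t₁) = n·K′(t₀) + R′(t₀) + R(t₁)`, so `|K − K′| ≤ 2` pointwise, and the floor bookkeeping [`floor_shift`] leaves exactly:
  `w = n/3 ⟹ K = K′ + 2`, forcing `R(t₁) = R(t₀) + n` (and `R′(t₀) = R′(t₁) + n`); `w = 2n/3 ⟹ K′ = K + 2`, forcing `R(t₀) = R(t₁) + n`.
  Applied at `(t₀, t₁) = (7, 1)` and `(49, 7)`: `R(1) = R(49) ± 2n`, contradicting `|R(1) − R(49)| ≤ n`.  (One step does not suffice —
  control LG.)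
CONSEQUENCES [`row_UZ1_seven`, `row_Z1Z1_seven`]: for every ODD `n` with `7 ∤ n` — `3 ∣ n` allowed, `n` not necessarily squarefree, no
joint primitivity — a (U, Z1) coincidence of CM type at level `7n` (Z1 entry `7y ≢ 0 (mod 7n)`) forces `n = 5·gcd(y, n)`, and a (Z1, Z1)
coincidence (`7y ≢ 7y′ (mod 7n)`) forces `n = 5·gcd(y − y′, n)`: THEOREM L's bounds give quotient `∈ {1, 3, 5, 7}` resp. `{1, 3, 5}` for odd
`n`; quotient 1 is `n ∣ y` resp. `y ≡ y′`, quotient 7 contradicts `7 ∤ n`, and quotient 3 is the two theorems above.  So the `p = 7` rows of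
THEOREM L's table (DPRIME §3) hold with quotient EXACTLY 5, in the kernel; PROPOSITION L7 (b) and the n′ = 3 branch of PROPOSITION L7 (a)
hold for EVERY `n`; and what remains of PROPOSITION D′ at `p = 7` outside the kernel is the n′ = 5 branch of (a) when `3 ∣ n` (ends F15a,
F105; for `3 ∤ n` it is `PropL7a.row_UZ1_seven_not3`, generation 22) and the residual (Z1, Z1) case `n = 5·gcd(y − y′, n)` of DPRIME §§6–14.

Imports `HodgeFermat.TheoremL13` only (hence `LemmaN`, `LemmaO`, `TheoremLRows`); uses `LemmaN.fibre_identity_Z1U`,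
`fibre_identity_Z1Z1`, `TheoremL.row_UZ1`, `row_Z1Z1`, `delta_le`, `dvd_of_level`, `diff_repr`, `val_cases`.  `set_option autoImplicit
false`; no `sorry`, no `decide`, no `native_decide`; axioms of every theorem = [propext, Classical.choice, Quot.sound]; hub `lean check`
of the 5-body record `check/SevenThree_standalone.lean` (LemmaN, LemmaO, TheoremLRows, TheoremL13, SevenThree under one `import
Mathlib`): rc 0, 0 errors, 0 warnings, ≈ 9 s (results/gen29/local/lean/SevenThree_standalone.check.json; planted controls LE/LF/LG rc 1).
Independent cross-check: `code/gen29/seven3_scan.py` (pure Python, first principles) finds NO quotient-3 coincidence of either row at the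
23 levels `7n ≤ 987` scanned (`n = 3, 9, 15, 27, 33, 39, 45, …, 135, 141`: EVERY `n ≤ 141` with `3 ∣ n`, `2 ∤ n`, `7 ∤ n` — squarefree
OR NOT —, plus the controls `n = 5, 55`), while its coincidence detector does fire on the (Z3, ·) lifts of lower-level coincidences
(84 pairs at level 105, 3240 over the 23 levels) — results/gen29/local/seven3_scan_987.txt, verdict `SEVEN3-SCAN GREEN`, 317 s.
-/

set_option autoImplicit false

namespace HodgeFermat.KRFree.SevenThree

open HodgeFermat.KRFree.LemmaN HodgeFermat.KRFree.TheoremL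

/-! ## 0. Residues at quotient 3 -/

/-- if `t ≡ 1 (mod 3)` and `n = 3·gcd(y, n)` then `⟨ty⟩_n = ⟨y⟩_n` (because `n = 3g ∣ (t − 1)·y`). -/
lemma mul_mod_of_one_mod_three {n y t : ℕ} (hn3 : n = 3 * Nat.gcd y n) (ht : t % 3 = 1) :
    t * y % n = y % n := by
  obtain ⟨g, hg⟩ : ∃ g, Nat.gcd y n = g := ⟨_, rfl⟩
  obtain ⟨c, hc⟩ : g ∣ y := hg ▸ Nat.gcd_dvd_left y n
  rw [hg] at hn3
  have key : t * y = y + n * (t / 3 * c) := by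
    obtain ⟨k, rfl⟩ : ∃ k, t = 3 * k + 1 := ⟨t / 3, by omega⟩
    have hk3 : (3 * k + 1) / 3 = k := by omega
    rw [hk3, hn3, hc]; ring
  rw [key, Nat.add_mul_mod_self_left]

/-- `(r + k·3g) / 3g = k` for `r < 3g` -/
lemma div_three_mul {g k r : ℕ} (hg : 0 < g) (hr : r < 3 * g) : (r + k * (3 * g)) / (3 * g) = k := by
  rw [Nat.add_mul_div_right _ _ (by omega : 0 < 3 * g), Nat.div_eq_of_lt hr, zero_add]

/-- the digit `K(t) = ⌊7⟨ty⟩_n / n⌋ ∈ {2, 4}` when `n = 3·gcd(y, n)`, according as `⟨ty⟩_n = n/3` or `2n/3` -/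
lemma K_seven {n y t : ℕ} (hn : 0 < n) (hn3 : n = 3 * Nat.gcd y n) (ht : Nat.Coprime t n) :
    (t * y % n = Nat.gcd y n ∧ 7 * (t * y % n) / n = 2) ∨
    (t * y % n = 2 * Nat.gcd y n ∧ 7 * (t * y % n) / n = 4) := by
  obtain ⟨g, hg⟩ : ∃ g, Nat.gcd y n = g := ⟨_, rfl⟩
  have hg0 : 0 < g := hg ▸ Nat.gcd_pos_of_pos_right _ hn
  have hv := val_cases n y t hn hn3 ht
  rw [hg] at hv hn3 ⊢
  rcases hv with h | h
  · left; refine ⟨h, ?_⟩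
    rw [h, hn3, show 7 * g = g + 2 * (3 * g) by ring]
    exact div_three_mul hg0 (by omega)
  · right; refine ⟨h, ?_⟩
    rw [h, hn3, show 7 * (2 * g) = 2 * g + 4 * (3 * g) by ring]
    exact div_three_mul hg0 (by omega)

/-- floor bookkeeping: `7a = 7b + s + c·n ⟹ ⌊7b/n⌋ + c ≤ ⌊7a/n⌋` -/
lemma floor_shift {n a b s c : ℕ} (hn : 0 < n) (h : 7 * a = 7 * b + s + c * n) :
    7 * b / n + c ≤ 7 * a / n := by
  rw [h, Nat.add_mul_div_right _ _ hn]
  exact Nat.add_le_add_right (Nat.div_le_div_right (Nat.le_add_right _ _)) c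

/-! ## 1. Row (U, Z1) at `p = 7` with `n = 3·gcd(y, n)`: impossible (three steps along `1, 7, 49, 343`) -/

/-- **PROPOSITION L7 (a), branch n′ = 3, for EVERY `n`** (`7 ∤ n`; no parity, squarefreeness or joint-primitivity
hypothesis): a triple `T = (7y, x₂, x₃)` of pattern Z1 at 7 with `n = 3·gcd(y, n)` and a triple `T′ = (x′, y′, z′)` of
pattern U at 7 never have the same CM type at level `7n`. -/
theorem uz1_seven_three (n y x₂ x₃ x' y' z' : ℕ) (h7n : ¬ 7 ∣ n) (hn : 0 < n) (hn3 : n = 3 * Nat.gcd y n)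
    (hs : 7 * n ∣ 7 * y + x₂ + x₃) (hx₂ : ¬ 7 ∣ x₂) (hx₃ : ¬ 7 ∣ x₃)
    (hs' : 7 * n ∣ x' + y' + z') (hx' : ¬ 7 ∣ x') (hy' : ¬ 7 ∣ y') (hz' : ¬ 7 ∣ z')
    (hH : SameType (7 * n) (7 * y, x₂, x₃) (x', y', z')) : False := by
  have hp : (7).Prime := by norm_num
  have hco : Nat.Coprime 7 n := (Nat.Prime.coprime_iff_not_dvd hp).mpr h7n
  -- the fibre identity (E), Z1–U, at a pair (t₀, t₁) with 7t₁ ≡ t₀ and t₀ ≡ 1 (mod 3): the digit is K(1)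
  have E : ∀ t₀ t₁ : ℕ, Nat.Coprime t₀ n → 7 * t₁ ≡ t₀ [MOD n] → t₀ % 3 = 1 →
      2 * n * (7 * (y % n) / n) + 2 * rsum n (7 * y, x₂, x₃) t₀ + 2 * rsum n (x', y', z') t₁ + n
        = 7 * n + 2 * rsum n (7 * y, x₂, x₃) t₁ + 2 * rsum n (x', y', z') t₀ := by
    intro t₀ t₁ ht₀ ht₁ h3
    have h := fibre_identity_Z1U 7 n y x₂ x₃ x' y' z' t₀ t₁ hp h7n hn hs hx₂ hx₃ hs' hx' hy' hz' ht₀ ht₁ hH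
    rw [mul_mod_of_one_mod_three hn3 h3] at h
    exact h
  have c1 : Nat.Coprime 1 n := Nat.coprime_one_left n
  have c49 : Nat.Coprime 49 n := by simpa using Nat.Coprime.pow_left 2 hco
  have c343 : Nat.Coprime 343 n := by simpa using Nat.Coprime.pow_left 3 hco
  have E1 := E 7 1 hco (by norm_num [Nat.ModEq]) (by norm_num)
  have E2 := E 49 7 c49 (by norm_num [Nat.ModEq]) (by norm_num)
  have E3 := E 343 49 c343 (by norm_num [Nat.ModEq]) (by norm_num)
  have hd := delta_le n (7 * y) x₂ x₃ 1 343 hn (dvd_of_level hs) c1 c343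
  have hd' := delta_le n x' y' z' 1 343 hn (dvd_of_level hs') c1 c343
  have hK := K_seven hn hn3 c1
  rw [one_mul] at hK
  rcases hK with ⟨-, hK⟩ | ⟨-, hK⟩ <;> rw [hK] at E1 E2 E3 <;> omega

/-- **THEOREM L, row (U, Z1) at p = 7, sharpened:** for every odd `n` with `7 ∤ n` (`3 ∣ n` allowed, squarefree or not), a
coincidence of CM type between `T = (7y, x₂, x₃)` (Z1 at 7, `7y ≢ 0 (mod 7n)`) and a unit triple `T′` forces `n = 5·gcd(y, n)` — i.e.
`5 ∣ n` and only the n′ = 5 branch of PROPOSITION L7 (a) can occur. -/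
theorem row_UZ1_seven (n y x₂ x₃ x' y' z' : ℕ) (h7n : ¬ 7 ∣ n) (hn : 0 < n) (hodd : Odd n)
    (hs : 7 * n ∣ 7 * y + x₂ + x₃) (hx₂ : ¬ 7 ∣ x₂) (hx₃ : ¬ 7 ∣ x₃)
    (hs' : 7 * n ∣ x' + y' + z') (hx' : ¬ 7 ∣ x') (hy' : ¬ 7 ∣ y') (hz' : ¬ 7 ∣ z') (hy : ¬ n ∣ y)
    (hH : SameType (7 * n) (7 * y, x₂, x₃) (x', y', z')) : n = 5 * Nat.gcd y n := by
  have hp : (7).Prime := by norm_num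
  have h := row_UZ1 7 n y x₂ x₃ x' y' z' hp h7n hn hs hx₂ hx₃ hs' hx' hy' hz' hy hH
  obtain ⟨g, hg⟩ : ∃ g, Nat.gcd y n = g := ⟨_, rfl⟩
  have hg0 : 0 < g := hg ▸ Nat.gcd_pos_of_pos_right _ hn
  obtain ⟨k, hk⟩ : g ∣ n := hg ▸ Nat.gcd_dvd_right y n
  rw [hg] at h ⊢
  have hk7 : k ≤ 7 := by
    by_contra hc
    have hc' : 8 ≤ k := by omega
    have := Nat.mul_le_mul_left g hc'
    omega
  have hodd' : Odd (g * k) := by rw [← hk]; exact hodd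
  have hk2 : k % 2 = 1 := Nat.odd_iff.mp (Nat.odd_mul.mp hodd').2
  interval_cases k
  · omega
  · exfalso; apply hy
    have hgy : g ∣ y := hg ▸ Nat.gcd_dvd_left y n
    rw [show g = n by omega] at hgy
    exact hgy
  · omega
  · exact (uz1_seven_three n y x₂ x₃ x' y' z' h7n hn (by rw [hg]; omega) hs hx₂ hx₃ hs' hx' hy' hz' hH).elim
  · omega
  · omega
  · omega
  · exact (h7n ⟨g, by omega⟩).elim

/-! ## 2. Row (Z1, Z1) at `p = 7` with `n = 3·gcd(y − y′, n)`: impossible (two steps along `1, 7, 49`) -/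

/-- POINTWISE (Z1/Z1) at `p = 7`, quotient 3 (`z = y − y′` represented by `y + (n−1)y′`, `n = 3·gcd(z, n)`): at a pair
`(t₀, t₁)` of units with `7t₁ ≡ t₀ (mod n)` and `t₀ ≡ 1 (mod 3)`,
`⟨z⟩_n = n/3 ⟹ R(t₁) = R(t₀) + n ∧ R′(t₀) = R′(t₁) + n`, `⟨z⟩_n = 2n/3 ⟹ R(t₀) = R(t₁) + n ∧ R′(t₁) = R′(t₀) + n`. -/
lemma pointwise_z1z1 {n y x₂ x₃ y' x₂' x₃' t₀ t₁ : ℕ} (h7n : ¬ 7 ∣ n) (hn : 0 < n)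
    (hs : 7 * n ∣ 7 * y + x₂ + x₃) (hx₂ : ¬ 7 ∣ x₂) (hx₃ : ¬ 7 ∣ x₃)
    (hs' : 7 * n ∣ 7 * y' + x₂' + x₃') (hx₂' : ¬ 7 ∣ x₂') (hx₃' : ¬ 7 ∣ x₃')
    (hn3 : n = 3 * Nat.gcd (y + (n - 1) * y') n)
    (hH : SameType (7 * n) (7 * y, x₂, x₃) (7 * y', x₂', x₃'))
    (ht₀ : Nat.Coprime t₀ n) (ht₁u : Nat.Coprime t₁ n) (ht₁ : 7 * t₁ ≡ t₀ [MOD n]) (h3 : t₀ % 3 = 1) :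
    ((y + (n - 1) * y') % n = Nat.gcd (y + (n - 1) * y') n ∧
        rsum n (7 * y, x₂, x₃) t₁ = rsum n (7 * y, x₂, x₃) t₀ + n ∧
        rsum n (7 * y', x₂', x₃') t₀ = rsum n (7 * y', x₂', x₃') t₁ + n) ∨
    ((y + (n - 1) * y') % n = 2 * Nat.gcd (y + (n - 1) * y') n ∧
        rsum n (7 * y, x₂, x₃) t₀ = rsum n (7 * y, x₂, x₃) t₁ + n ∧
        rsum n (7 * y', x₂', x₃') t₁ = rsum n (7 * y', x₂', x₃') t₀ + n) := by
  have hp : (7).Prime := by norm_num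
  have hsum : y + (n - 1) * y' + y' = y + n * y' := by zify [hn]; ring
  have hE := fibre_identity_Z1Z1 7 n y x₂ x₃ y' x₂' x₃' t₀ t₁ hp h7n hn hs hx₂ hx₃ hs' hx₂' hx₃' ht₀ ht₁ hH
  have hd := delta_le n (7 * y) x₂ x₃ t₀ t₁ hn (dvd_of_level hs) ht₀ ht₁u
  have hd' := delta_le n (7 * y') x₂' x₃' t₀ t₁ hn (dvd_of_level hs') ht₀ ht₁u
  -- ⟨z⟩ + ⟨t₀y′⟩ ≡ ⟨t₀y⟩ (mod n), using ⟨t₀z⟩ = ⟨z⟩ (t₀ ≡ 1 mod 3)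
  have hrel : ((y + (n - 1) * y') % n + t₀ * y' % n) % n = t₀ * y % n := by
    have h0 : (t₀ * (y + (n - 1) * y') % n + t₀ * y' % n) % n = t₀ * y % n := by
      rw [← Nat.add_mod, ← Nat.mul_add, hsum, Nat.mul_add, ← mul_assoc, mul_comm t₀ n, mul_assoc,
        Nat.add_mul_mod_self_left]
    rwa [mul_mod_of_one_mod_three hn3 h3] at h0
  have hval := val_cases n (y + (n - 1) * y') 1 hn hn3 (Nat.coprime_one_left n)
  rw [one_mul] at hval
  -- opaque names
  obtain ⟨g, hg⟩ : ∃ g, Nat.gcd (y + (n - 1) * y') n = g := ⟨_, rfl⟩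
  obtain ⟨w, hw⟩ : ∃ w, (y + (n - 1) * y') % n = w := ⟨_, rfl⟩
  obtain ⟨v, hv⟩ : ∃ v, t₀ * y % n = v := ⟨_, rfl⟩
  obtain ⟨v', hv'⟩ : ∃ v', t₀ * y' % n = v' := ⟨_, rfl⟩
  have hvn : v < n := hv ▸ Nat.mod_lt _ hn
  have hvn' : v' < n := hv' ▸ Nat.mod_lt _ hn
  rw [hg, hw] at hval ⊢
  rw [hg] at hn3
  rw [hw, hv, hv'] at hrel
  rw [hv, hv'] at hE
  -- w + v′ = v or v + n
  have hq := Nat.div_add_mod (w + v') n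
  rw [hrel] at hq
  have hq2 : (w + v') / n < 2 := Nat.div_lt_of_lt_mul (by omega)
  obtain ⟨q, hqd⟩ : ∃ q, (w + v') / n = q := ⟨_, rfl⟩
  rw [hqd] at hq hq2
  -- the two digits
  obtain ⟨k, hk⟩ : ∃ k, 7 * v / n = k := ⟨_, rfl⟩
  obtain ⟨k', hk'⟩ : ∃ k', 7 * v' / n = k' := ⟨_, rfl⟩
  rw [hk, hk'] at hE
  interval_cases q
  · -- v = w + v′
    rcases hval with hw1 | hw2
    · -- k ≥ k′ + 2, hence (deltas) R′(t₀) − R′(t₁) = R(t₁) − R(t₀) = n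
      have f := floor_shift (c := 2) hn (show 7 * v = 7 * v' + g + 2 * n by omega)
      rw [hk, hk'] at f
      have f2 := Nat.mul_le_mul_left n f
      have e2 : n * (k' + 2) = n * k' + 2 * n := by ring
      left; refine ⟨hw1, ?_, ?_⟩ <;> omega
    · -- k ≥ k′ + 4: impossible
      have f := floor_shift (c := 4) hn (show 7 * v = 7 * v' + 2 * g + 4 * n by omega)
      rw [hk, hk'] at f
      have f4 := Nat.mul_le_mul_left n f
      have e4 : n * (k' + 4) = n * k' + 4 * n := by ring
      omega
  · -- v + n = w + v′
    rcases hval with hw1 | hw2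
    · -- v′ = v + 2g: k′ ≥ k + 4, impossible
      have f := floor_shift (c := 4) hn (show 7 * v' = 7 * v + 2 * g + 4 * n by omega)
      rw [hk, hk'] at f
      have f4 := Nat.mul_le_mul_left n f
      have e4 : n * (k + 4) = n * k + 4 * n := by ring
      omega
    · -- v′ = v + g: k′ ≥ k + 2
      have f := floor_shift (c := 2) hn (show 7 * v' = 7 * v + g + 2 * n by omega)
      rw [hk, hk'] at f
      have f2 := Nat.mul_le_mul_left n f
      have e2 : n * (k + 2) = n * k + 2 * n := by ring
      right; refine ⟨hw2, ?_, ?_⟩ <;> omega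

/-- **PROPOSITION L7 (b) for EVERY `n`** (`7 ∤ n`; no parity, squarefreeness or joint-primitivity hypothesis, and no
certificate): two triples `T = (7y, x₂, x₃)`, `T′ = (7y′, x₂′, x₃′)` of pattern Z1 at 7 with `n = 3·gcd(y − y′, n)` never
have the same CM type at level `7n`. -/
theorem z1z1_seven_three (n y x₂ x₃ y' x₂' x₃' : ℕ) (h7n : ¬ 7 ∣ n) (hn : 0 < n)
    (hs : 7 * n ∣ 7 * y + x₂ + x₃) (hx₂ : ¬ 7 ∣ x₂) (hx₃ : ¬ 7 ∣ x₃)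
    (hs' : 7 * n ∣ 7 * y' + x₂' + x₃') (hx₂' : ¬ 7 ∣ x₂') (hx₃' : ¬ 7 ∣ x₃')
    (hn3 : n = 3 * Nat.gcd (y + (n - 1) * y') n)
    (hH : SameType (7 * n) (7 * y, x₂, x₃) (7 * y', x₂', x₃')) : False := by
  have hp : (7).Prime := by norm_num
  have hco : Nat.Coprime 7 n := (Nat.Prime.coprime_iff_not_dvd hp).mpr h7n
  have c1 : Nat.Coprime 1 n := Nat.coprime_one_left n
  have c49 : Nat.Coprime 49 n := by simpa using Nat.Coprime.pow_left 2 hco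
  have P1 := pointwise_z1z1 h7n hn hs hx₂ hx₃ hs' hx₂' hx₃' hn3 hH hco c1
    (by norm_num [Nat.ModEq]) (by norm_num)
  have P2 := pointwise_z1z1 h7n hn hs hx₂ hx₃ hs' hx₂' hx₃' hn3 hH c49 hco
    (by norm_num [Nat.ModEq]) (by norm_num)
  have hd := delta_le n (7 * y) x₂ x₃ 1 49 hn (dvd_of_level hs) c1 c49
  have hg0 : 0 < Nat.gcd (y + (n - 1) * y') n := Nat.gcd_pos_of_pos_right _ hn
  rcases P1 with ⟨h1, a1, -⟩ | ⟨h1, a1, -⟩ <;> rcases P2 with ⟨h2, a2, -⟩ | ⟨h2, a2, -⟩ <;> omega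

/-- **THEOREM L, row (Z1, Z1) at p = 7, sharpened:** for every odd `n` with `7 ∤ n`, a coincidence of CM type between
`T = (7y, x₂, x₃)` and `T′ = (7y′, x₂′, x₃′)` (both Z1 at 7, `7y ≢ 7y′ (mod 7n)`) forces `n = 5·gcd(y − y′, n)` — i.e.
`5 ∣ n` and `7y ≡ 7y′ (mod 7n/5)`: exactly the residual case of PROPOSITION L7. -/
theorem row_Z1Z1_seven (n y x₂ x₃ y' x₂' x₃' : ℕ) (h7n : ¬ 7 ∣ n) (hn : 0 < n) (hodd : Odd n)
    (hs : 7 * n ∣ 7 * y + x₂ + x₃) (hx₂ : ¬ 7 ∣ x₂) (hx₃ : ¬ 7 ∣ x₃)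
    (hs' : 7 * n ∣ 7 * y' + x₂' + x₃') (hx₂' : ¬ 7 ∣ x₂') (hx₃' : ¬ 7 ∣ x₃')
    (hyy' : ¬ y ≡ y' [MOD n])
    (hH : SameType (7 * n) (7 * y, x₂, x₃) (7 * y', x₂', x₃')) :
    n = 5 * Nat.gcd (y + (n - 1) * y') n := by
  have hp : (7).Prime := by norm_num
  have hlt := row_Z1Z1 7 n y x₂ x₃ y' x₂' x₃' hp le_rfl h7n hn hodd hs hx₂ hx₃ hs' hx₂' hx₃' hyy' hH
  obtain ⟨-, hnz⟩ := diff_repr n y y' hn hyy'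
  obtain ⟨g, hg⟩ : ∃ g, Nat.gcd (y + (n - 1) * y') n = g := ⟨_, rfl⟩
  have hg0 : 0 < g := hg ▸ Nat.gcd_pos_of_pos_right _ hn
  obtain ⟨k, hk⟩ : g ∣ n := hg ▸ Nat.gcd_dvd_right _ n
  rw [hg] at hlt ⊢
  have hk7 : k < 7 := by
    by_contra hc
    have hc' : 7 ≤ k := by omega
    have := Nat.mul_le_mul_left g hc'
    omega
  have hodd' : Odd (g * k) := by rw [← hk]; exact hodd
  have hk2 : k % 2 = 1 := Nat.odd_iff.mp (Nat.odd_mul.mp hodd').2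
  interval_cases k
  · omega
  · exfalso; apply hnz
    have hgz : g ∣ y + (n - 1) * y' := hg ▸ Nat.gcd_dvd_left _ n
    rw [show g = n by omega] at hgz
    exact hgz
  · omega
  · exact (z1z1_seven_three n y x₂ x₃ y' x₂' x₃' h7n hn hs hx₂ hx₃ hs' hx₂' hx₃' (by rw [hg]; omega) hH).elim
  · omega
  · omega
  · omega

end HodgeFermat.KRFree.SevenThree
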